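import Mathlib.NumberTheory.Harmonic.Bounds
import Mathlib.Data.Nat.Factorization.Basic
import Mathlib.Data.Nat.Squarefree
import Mathlib.Analysis.SpecialFunctions.Pow.Real
import Mathlib.Algebra.Order.Floor.Semifield
import HarnessLib

/-!
# The square-full / square-free decomposition `n = b n'`

Every `n ≥ 1` factors uniquely as `n = b n'` with `n'` square-free, `b` square-full
(`p ∣ b ⇒ p² ∣ b`) and `(b, n') = 1` (`b = ∏_{p² ∣ n} p^{v_p(n)}`, `n' = ∏_{p ∥ n} p`).  This is the
device of Bettin–Chandee, *Trilinear forms with Kloosterman fractions* (arXiv:1502.00769), §6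
("We write `n = bn'`, where `n'` is square-free, `b` is square-full, and `(b,n') = 1`"), used to
remove the square-free condition in the bilinear Kloosterman-fraction bound.  We prove the
resulting regrouping of a sum over `n ≤ 2N` (`sqf_regroup`) and the bound
`Σ_{b ≤ X square-full} b^{-1/2} ≤ T (1 + log X)` for any bound `T` of `τ` on `[1, X]`
(`sqf_sum_rsqrt_le`, via `b = a²c`, `c ∣ a`).

The decomposition functions are section variables `fp`, `sp` with defining equations `hfp`,
`hsp` (no new definitions are introduced); `sqf_regroup` eliminates them.

## References
* S. Bettin, V. Chandee, Adv. Math. 328 (2018), arXiv:1502.00769, §6. [cite: BettinChandee2018, §6]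
-/

noncomputable section

open Finset

namespace Literature.NumberTheory.LFunctions

section Decomp

variable (fp sp : ℕ → ℕ)
  (hfp : ∀ n, fp n = (n.factorization.filter (fun p => ¬ n.factorization p < 2)).prod (· ^ ·))
  (hsp : ∀ n, sp n = (n.factorization.filter (fun p => n.factorization p < 2)).prod (· ^ ·))

include hfp hsp in
/-- `fp n · sp n = n`. [folklore] -/
theorem sqf_fp_mul_sp {n : ℕ} (hn : n ≠ 0) : fp n * sp n = n := by
  rw [hfp, hsp, mul_comm, ← Finsupp.prod_add_index' (h := fun p e => p ^ e)
    (fun _ => pow_zero _) (fun _ _ _ => pow_add _ _ _), Finsupp.filter_add_filter_not]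
  exact Nat.prod_factorization_pow_eq_self hn

include hfp in
/-- The factorization of `fp n`. [folklore] -/
theorem sqf_factorization_fp (n : ℕ) :
    (fp n).factorization = n.factorization.filter (fun p => ¬ n.factorization p < 2) := by
  rw [hfp]
  refine Nat.prod_pow_factorization_eq_self fun p hp => ?_
  rw [Finsupp.support_filter] at hp
  exact Nat.prime_of_mem_primeFactors (Nat.support_factorization n ▸ (Finset.mem_filter.mp hp).1)

include hsp in
/-- The factorization of `sp n`. [folklore] -/
theorem sqf_factorization_sp (n : ℕ) :
    (sp n).factorization = n.factorization.filter (fun p => n.factorization p < 2) := by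
  rw [hsp]
  refine Nat.prod_pow_factorization_eq_self fun p hp => ?_
  rw [Finsupp.support_filter] at hp
  exact Nat.prime_of_mem_primeFactors (Nat.support_factorization n ▸ (Finset.mem_filter.mp hp).1)

include hfp hsp in
/-- `fp n ≠ 0` and `sp n ≠ 0` for `n ≠ 0`. [folklore] -/
theorem sqf_ne_zero {n : ℕ} (hn : n ≠ 0) : fp n ≠ 0 ∧ sp n ≠ 0 := by
  have h := sqf_fp_mul_sp fp sp hfp hsp hn
  constructor
  · rintro h0; rw [h0, zero_mul] at h; exact hn h.symm
  · rintro h0; rw [h0, mul_zero] at h; exact hn h.symm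

include hfp hsp in
/-- `sp n` is square-free. [folklore] -/
theorem sqf_sp_squarefree {n : ℕ} (hn : n ≠ 0) : Squarefree (sp n) := by
  rw [Nat.squarefree_iff_factorization_le_one (sqf_ne_zero fp sp hfp hsp hn).2,
    sqf_factorization_sp sp hsp n]
  intro p
  rw [Finsupp.filter_apply]
  split_ifs with h
  · omega
  · exact zero_le_one

include hfp hsp in
/-- `(sp n, fp n) = 1`. [folklore] -/
theorem sqf_coprime {n : ℕ} (hn : n ≠ 0) : (sp n).Coprime (fp n) := by
  obtain ⟨hf0, hs0⟩ := sqf_ne_zero fp sp hfp hsp hn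
  refine Nat.coprime_of_dvd fun p hp h1 h2 => ?_
  have e1 := (hp.dvd_iff_one_le_factorization hs0).mp h1
  have e2 := (hp.dvd_iff_one_le_factorization hf0).mp h2
  rw [sqf_factorization_sp sp hsp n, Finsupp.filter_apply] at e1
  rw [sqf_factorization_fp fp hfp n, Finsupp.filter_apply] at e2
  split_ifs at e1 e2 <;> omega

include hfp in
/-- `fp n` is square-full. [folklore] -/
theorem sqf_fp_sqfull (n : ℕ) : ∀ p ∈ (fp n).primeFactors, p ^ 2 ∣ fp n := by
  intro p hp
  have hpp := Nat.prime_of_mem_primeFactors hp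
  have hf0 : fp n ≠ 0 := (Nat.mem_primeFactors.mp hp).2.2
  have h1 := (hpp.dvd_iff_one_le_factorization hf0).mp (Nat.dvd_of_mem_primeFactors hp)
  rw [hpp.pow_dvd_iff_le_factorization hf0]
  rw [sqf_factorization_fp fp hfp n, Finsupp.filter_apply] at h1 ⊢
  split_ifs at h1 ⊢ with h <;> omega

include hfp hsp in
/-- For `b` square-full, `n'` square-free and `(n', b) = 1`: `fp (b n') = b`, `sp (b n') = n'`.
[folklore] -/
theorem sqf_of_decomp {b n' : ℕ} (hb : b ≠ 0) (hn' : n' ≠ 0) (hsq : Squarefree n')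
    (hcop : n'.Coprime b) (hfull : ∀ p ∈ b.primeFactors, p ^ 2 ∣ b) :
    fp (b * n') = b ∧ sp (b * n') = n' := by
  have hbn : b * n' ≠ 0 := mul_ne_zero hb hn'
  have hfac : (b * n').factorization = b.factorization + n'.factorization :=
    Nat.factorization_mul hb hn'
  have hsq' := (Nat.squarefree_iff_factorization_le_one hn').mp hsq
  -- values of the two factorizations at a prime
  have hval : ∀ p, p.Prime →
      (p ∣ b → 2 ≤ b.factorization p ∧ n'.factorization p = 0) ∧
      (¬ p ∣ b → b.factorization p = 0) := by
    intro p hp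
    constructor
    · intro hpb
      refine ⟨(hp.pow_dvd_iff_le_factorization hb).mp
        (hfull p (Nat.mem_primeFactors.mpr ⟨hp, hpb, hb⟩)), ?_⟩
      refine Nat.factorization_eq_zero_of_not_dvd fun hpn => ?_
      exact hp.one_lt.ne' ((hcop.coprime_dvd_left hpn).eq_one_of_dvd hpb)
    · intro hpb
      exact Nat.factorization_eq_zero_of_not_dvd hpb
  have key2 : (b * n').factorization.filter (fun p => ¬ (b * n').factorization p < 2) =
      b.factorization := by
    ext p
    rw [Finsupp.filter_apply, hfac, Finsupp.add_apply]
    by_cases hp : p.Prime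
    · by_cases hpb : p ∣ b
      · obtain ⟨h2, h3⟩ := (hval p hp).1 hpb
        rw [h3, add_zero, if_pos (by omega)]
      · have h0 := (hval p hp).2 hpb
        have h1 := hsq' p
        rw [h0, zero_add, if_neg (by omega)]
    · simp [Nat.factorization_eq_zero_of_not_prime _ hp]
  have key1 : (b * n').factorization.filter (fun p => (b * n').factorization p < 2) =
      n'.factorization := by
    ext p
    rw [Finsupp.filter_apply, hfac, Finsupp.add_apply]
    by_cases hp : p.Prime
    · by_cases hpb : p ∣ b
      · obtain ⟨h2, h3⟩ := (hval p hp).1 hpb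
        rw [h3, add_zero, if_neg (by omega)]
      · have h0 := (hval p hp).2 hpb
        have h1 := hsq' p
        rw [h0, zero_add, if_pos (by omega)]
    · simp [Nat.factorization_eq_zero_of_not_prime _ hp]
  constructor
  · rw [hfp, key2, Nat.prod_factorization_pow_eq_self hb]
  · rw [hsp, key1, Nat.prod_factorization_pow_eq_self hn']

end Decomp

/-! ### Regrouping a sum over `n` by the square-full part -/

/-- **Regrouping by the square-full part** (B–C §6, "we write `n = bn'`"):
`Σ_{n ≤ 2N} F(n) = Σ_{b ≤ 2N square-full} Σ_{n' ≤ 2N/b, n' square-free, (n',b)=1} F(b n')`.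
[cite: BettinChandee2018, §6] -/
theorem sqf_regroup {E : Type*} [AddCommMonoid E] (N : ℝ) (F : ℕ → E) :
    ∑ n ∈ Icc 1 ⌊2 * N⌋₊, F n =
      ∑ b ∈ (Icc 1 ⌊2 * N⌋₊).filter (fun b => ∀ p ∈ b.primeFactors, p ^ 2 ∣ b),
        ∑ n' ∈ (Icc 1 ⌊2 * (N / b)⌋₊).filter (fun n' => Squarefree n' ∧ n'.Coprime b),
          F (b * n') := by
  obtain ⟨fp, hfp⟩ : ∃ fp : ℕ → ℕ, ∀ n, fp n =
      (n.factorization.filter (fun p => ¬ n.factorization p < 2)).prod (· ^ ·) := ⟨_, fun _ => rfl⟩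
  obtain ⟨sp, hsp⟩ : ∃ sp : ℕ → ℕ, ∀ n, sp n =
      (n.factorization.filter (fun p => n.factorization p < 2)).prod (· ^ ·) := ⟨_, fun _ => rfl⟩
  set X := ⌊2 * N⌋₊ with hX
  set Bset := (Icc 1 X).filter (fun b => ∀ p ∈ b.primeFactors, p ^ 2 ∣ b) with hBset
  set Iset : ℕ → Finset ℕ := fun b =>
    (Icc 1 ⌊2 * (N / b)⌋₊).filter (fun n' => Squarefree n' ∧ n'.Coprime b) with hIset
  have hfloor : ∀ b : ℕ, 0 < b → ⌊2 * (N / b)⌋₊ = X / b := by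
    intro b hb
    rw [show (2 : ℝ) * (N / b) = 2 * N / b by ring, Nat.floor_div_natCast]
  have hIsub : ∀ b ∈ Bset, Iset b ⊆ Icc 1 X := by
    intro b hb n' hn'
    have hb1 : 0 < b := (Finset.mem_Icc.mp (Finset.mem_filter.mp hb).1).1
    have h := Finset.mem_Icc.mp (Finset.mem_filter.mp hn').1
    rw [hfloor b hb1] at h
    exact Finset.mem_Icc.mpr ⟨h.1, h.2.trans (Nat.div_le_self _ _)⟩
  -- the right-hand side as a sum over a product set
  set S := (Bset ×ˢ Icc 1 X).filter (fun q : ℕ × ℕ => q.2 ∈ Iset q.1) with hS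
  have hRHS : ∑ b ∈ Bset, ∑ n' ∈ Iset b, F (b * n') = ∑ q ∈ S, F (q.1 * q.2) := by
    symm
    calc ∑ q ∈ S, F (q.1 * q.2)
        = ∑ q ∈ Bset ×ˢ Icc 1 X, (if q.2 ∈ Iset q.1 then F (q.1 * q.2) else 0) :=
          Finset.sum_filter _ _
      _ = ∑ b ∈ Bset, ∑ n' ∈ Icc 1 X, (if n' ∈ Iset b then F (b * n') else 0) :=
          Finset.sum_product _ _ _
      _ = ∑ b ∈ Bset, ∑ n' ∈ Iset b, F (b * n') := by
          refine Finset.sum_congr rfl fun b hb => ?_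
          rw [← Finset.sum_filter, Finset.filter_mem_eq_inter,
            Finset.inter_eq_right.mpr (hIsub b hb)]
  show ∑ n ∈ Icc 1 X, F n = ∑ b ∈ Bset, ∑ n' ∈ Iset b, F (b * n')
  rw [hRHS]
  refine Finset.sum_nbij' (fun n => (fp n, sp n)) (fun q : ℕ × ℕ => q.1 * q.2) ?_ ?_ ?_ ?_ ?_
  · intro n hn
    have hnI := Finset.mem_Icc.mp hn
    have hn0 : n ≠ 0 := by omega
    obtain ⟨hf0, hs0⟩ := sqf_ne_zero fp sp hfp hsp hn0
    have hmul := sqf_fp_mul_sp fp sp hfp hsp hn0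
    have hfle : fp n ≤ n := Nat.le_of_dvd (by omega) ⟨sp n, hmul.symm⟩
    have hsdiv : sp n = n / fp n := by
      rw [← Nat.mul_div_cancel_left (sp n) (Nat.pos_of_ne_zero hf0), hmul]
    have hfB : fp n ∈ Bset := Finset.mem_filter.mpr
      ⟨Finset.mem_Icc.mpr ⟨Nat.pos_of_ne_zero hf0, hfle.trans hnI.2⟩, sqf_fp_sqfull fp hfp n⟩
    have hsI : sp n ∈ Iset (fp n) := by
      refine Finset.mem_filter.mpr ⟨?_, sqf_sp_squarefree fp sp hfp hsp hn0,
        sqf_coprime fp sp hfp hsp hn0⟩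
      rw [Finset.mem_Icc, hfloor _ (Nat.pos_of_ne_zero hf0)]
      exact ⟨Nat.pos_of_ne_zero hs0, hsdiv ▸ Nat.div_le_div_right hnI.2⟩
    exact Finset.mem_filter.mpr ⟨Finset.mem_product.mpr ⟨hfB, hIsub _ hfB hsI⟩, hsI⟩
  · intro q hq
    have hq' := Finset.mem_filter.mp hq
    have hb := (Finset.mem_product.mp hq'.1).1
    have hb1 : 0 < q.1 := (Finset.mem_Icc.mp (Finset.mem_filter.mp hb).1).1
    have hn' := Finset.mem_Icc.mp (Finset.mem_filter.mp hq'.2).1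
    rw [hfloor _ hb1] at hn'
    rw [Finset.mem_Icc]
    refine ⟨Nat.mul_pos hb1 hn'.1, ?_⟩
    exact (Nat.mul_le_mul_left q.1 hn'.2).trans (Nat.mul_div_le _ _)
  · intro n hn
    have hn0 : n ≠ 0 := by have := (Finset.mem_Icc.mp hn).1; omega
    exact sqf_fp_mul_sp fp sp hfp hsp hn0
  · intro q hq
    have hq' := Finset.mem_filter.mp hq
    have hb := Finset.mem_filter.mp (Finset.mem_product.mp hq'.1).1
    have hb0 : q.1 ≠ 0 := by have := (Finset.mem_Icc.mp hb.1).1; omega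
    have hn' := Finset.mem_filter.mp hq'.2
    have hn'0 : q.2 ≠ 0 := by have := (Finset.mem_Icc.mp hn'.1).1; omega
    obtain ⟨h1, h2⟩ := sqf_of_decomp fp sp hfp hsp hb0 hn'0 hn'.2.1 hn'.2.2 hb.2
    exact Prod.ext h1 h2
  · intro n hn
    have hn0 : n ≠ 0 := by have := (Finset.mem_Icc.mp hn).1; omega
    simp only [sqf_fp_mul_sp fp sp hfp hsp hn0]

/-- `Σ_{b square-full} Σ_{n'} ‖β(bn')‖² = ‖β‖²` in the form used later: with
`γ_b(n') = β(bn')` on square-free `n'` coprime to `b` and `0` otherwise,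
`Σ_b Σ_{n' ≤ 2N/b} ‖γ_b(n')‖² = Σ_{n ≤ 2N} ‖β(n)‖²`. [cite: BettinChandee2018, §6] -/
theorem sqf_sum_norm_sq (N : ℝ) (β : ℕ → ℂ) :
    ∑ b ∈ (Icc 1 ⌊2 * N⌋₊).filter (fun b => ∀ p ∈ b.primeFactors, p ^ 2 ∣ b),
      ∑ n' ∈ Icc 1 ⌊2 * (N / b)⌋₊,
        ‖(if (Squarefree n' ∧ n'.Coprime b) then β (b * n') else 0)‖ ^ 2 =
      ∑ n ∈ Icc 1 ⌊2 * N⌋₊, ‖β n‖ ^ 2 := by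
  rw [sqf_regroup N (fun n => ‖β n‖ ^ 2)]
  refine Finset.sum_congr rfl fun b _ => ?_
  rw [Finset.sum_filter]
  refine Finset.sum_congr rfl fun n' _ => ?_
  split_ifs <;> simp

/-! ### `Σ_{b square-full ≤ X} b^{-1/2} ≪ τ-bound · log X` -/

/-- Harmonic sum: `Σ_{a ≤ X} 1/a ≤ 1 + log X`. [folklore] -/
theorem sqf_harmonic_le (X : ℕ) : ∑ a ∈ Icc 1 X, (1 / (a : ℝ)) ≤ 1 + Real.log X := by
  have h1 : ∑ a ∈ Icc 1 X, (1 / (a : ℝ)) = ((harmonic X : ℚ) : ℝ) := by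
    rw [harmonic_eq_sum_Icc, Rat.cast_sum]
    refine Finset.sum_congr rfl fun a _ => ?_
    rw [Rat.cast_inv, Rat.cast_natCast, one_div]
  rw [h1]
  exact harmonic_le_one_add_log X

/-- **Square-full numbers are `a²c` with `c ∣ a`**, whence
`Σ_{b ≤ X square-full} b^{-1/2} ≤ Σ_{a ≤ X} τ(a)/a ≤ T (1 + log X)` for any bound `T ≥ τ(a)`,
`a ≤ X` (B–C §6: "`Σ_{b square-full} b^{-1/2} … ≪ M^ε`"). [cite: BettinChandee2018, §6] -/
theorem sqf_sum_rsqrt_le (X : ℕ) {T : ℝ} (hT0 : 0 ≤ T)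
    (hT : ∀ a ∈ Icc 1 X, (a.divisors.card : ℝ) ≤ T) :
    ∑ b ∈ (Icc 1 X).filter (fun b => ∀ p ∈ b.primeFactors, p ^ 2 ∣ b),
      (1 / Real.sqrt (b : ℝ)) ≤ T * (1 + Real.log X) := by
  obtain ⟨ah, hah⟩ : ∃ ah : ℕ → ℕ, ∀ b, ah b =
      (b.factorization.mapRange (fun e => e / 2) (Nat.zero_div 2)).prod (· ^ ·) :=
    ⟨_, fun _ => rfl⟩
  set Bset := (Icc 1 X).filter (fun b => ∀ p ∈ b.primeFactors, p ^ 2 ∣ b) with hBset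
  -- facts about `ah b` for square-full `b`
  have hfac : ∀ b, (ah b).factorization = b.factorization.mapRange (fun e => e / 2)
      (Nat.zero_div 2) := by
    intro b
    rw [hah]
    refine Nat.prod_pow_factorization_eq_self fun p hp => ?_
    have : p ∈ b.factorization.support := Finsupp.support_mapRange hp
    exact Nat.prime_of_mem_primeFactors (Nat.support_factorization b ▸ this)
  have hne : ∀ b, ah b ≠ 0 := by
    intro b
    rw [hah, Finsupp.prod_ne_zero_iff]
    intro p hp
    have : p ∈ b.factorization.support := Finsupp.support_mapRange hp
    exact pow_ne_zero _ (Nat.prime_of_mem_primeFactors (Nat.support_factorization b ▸ this)).ne_zero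
  have hsq_dvd : ∀ b, b ≠ 0 → ah b ^ 2 ∣ b := by
    intro b hb
    rw [← Nat.factorization_le_iff_dvd (pow_ne_zero 2 (hne b)) hb, Nat.factorization_pow, hfac]
    intro p
    rw [Finsupp.smul_apply, Finsupp.mapRange_apply, smul_eq_mul]
    exact Nat.mul_div_le _ 2
  have hquot_dvd : ∀ b ∈ Bset, b / ah b ^ 2 ∣ ah b := by
    intro b hb
    have hb' := Finset.mem_filter.mp hb
    have hb0 : b ≠ 0 := by have := (Finset.mem_Icc.mp hb'.1).1; omega
    have hq0 : b / ah b ^ 2 ≠ 0 := by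
      intro h
      have := Nat.div_mul_cancel (hsq_dvd b hb0)
      rw [h, zero_mul] at this
      exact hb0 this.symm
    rw [← Nat.factorization_le_iff_dvd hq0 (hne b), Nat.factorization_div (hsq_dvd b hb0),
      Nat.factorization_pow, hfac]
    intro p
    rw [Finsupp.tsub_apply, Finsupp.smul_apply, Finsupp.mapRange_apply, smul_eq_mul]
    -- `e - 2 (e/2) ≤ e/2` unless `e = 1`, which is excluded for square-full `b`
    have hne1 : b.factorization p ≠ 1 := by
      intro h1
      have hp : p.Prime := by
        by_contra hp
        rw [Nat.factorization_eq_zero_of_not_prime _ hp] at h1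
        exact zero_ne_one h1
      have hpb : p ∣ b := (hp.dvd_iff_one_le_factorization hb0).mpr (by omega)
      have h2 := (hp.pow_dvd_iff_le_factorization hb0).mp
        (hb'.2 p (Nat.mem_primeFactors.mpr ⟨hp, hpb, hb0⟩))
      omega
    omega
  have hle : ∀ b ∈ Bset, ah b ∈ Icc 1 X ∧ 1 / Real.sqrt (b : ℝ) ≤ 1 / (ah b : ℝ) := by
    intro b hb
    have hb' := Finset.mem_filter.mp hb
    have hbI := Finset.mem_Icc.mp hb'.1
    have hb0 : b ≠ 0 := by omega
    have h1 : ah b ^ 2 ≤ b := Nat.le_of_dvd (by omega) (hsq_dvd b hb0)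
    have h2 : ah b ≤ ah b ^ 2 := by
      calc ah b = ah b * 1 := (mul_one _).symm
        _ ≤ ah b * ah b := Nat.mul_le_mul_left _ (Nat.pos_of_ne_zero (hne b))
        _ = ah b ^ 2 := (sq _).symm
    refine ⟨Finset.mem_Icc.mpr ⟨Nat.pos_of_ne_zero (hne b), h2.trans (h1.trans hbI.2)⟩, ?_⟩
    have h3 : (ah b : ℝ) ≤ Real.sqrt b := by
      rw [Real.le_sqrt (Nat.cast_nonneg _) (Nat.cast_nonneg _)]
      exact_mod_cast h1
    have h4 : (0 : ℝ) < ah b := by exact_mod_cast Nat.pos_of_ne_zero (hne b)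
    exact one_div_le_one_div_of_le h4 h3
  -- the estimate
  calc ∑ b ∈ Bset, (1 / Real.sqrt (b : ℝ)) ≤ ∑ b ∈ Bset, (1 / (ah b : ℝ)) :=
        Finset.sum_le_sum fun b hb => (hle b hb).2
    _ = ∑ a ∈ Icc 1 X, ∑ b ∈ Bset.filter (fun b => ah b = a), (1 / (ah b : ℝ)) :=
        (Finset.sum_fiberwise_of_maps_to (g := ah) (fun b hb => (hle b hb).1) _).symm
    _ = ∑ a ∈ Icc 1 X, ((Bset.filter (fun b => ah b = a)).card : ℝ) * (1 / (a : ℝ)) := by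
        refine Finset.sum_congr rfl fun a _ => ?_
        rw [Finset.sum_congr rfl fun b hb => by rw [(Finset.mem_filter.mp hb).2],
          Finset.sum_const, nsmul_eq_mul]
    _ ≤ ∑ a ∈ Icc 1 X, (a.divisors.card : ℝ) * (1 / (a : ℝ)) := by
        refine Finset.sum_le_sum fun a ha => mul_le_mul_of_nonneg_right ?_ (by positivity)
        have ha0 : a ≠ 0 := by have := (Finset.mem_Icc.mp ha).1; omega
        have hinj : Set.InjOn (fun b => b / ah b ^ 2) (Bset.filter (fun b => ah b = a)) := by
          intro b₁ hb₁ b₂ hb₂ h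
          have hb₁' : b₁ ∈ Bset.filter (fun b => ah b = a) := by simpa using hb₁
          have hb₂' : b₂ ∈ Bset.filter (fun b => ah b = a) := by simpa using hb₂
          obtain ⟨hB₁, ha₁⟩ := Finset.mem_filter.mp hb₁'
          obtain ⟨hB₂, ha₂⟩ := Finset.mem_filter.mp hb₂'
          have h0₁ : b₁ ≠ 0 := by
            have := (Finset.mem_Icc.mp (Finset.mem_filter.mp hB₁).1).1; omega
          have h0₂ : b₂ ≠ 0 := by
            have := (Finset.mem_Icc.mp (Finset.mem_filter.mp hB₂).1).1; omega
          have e₁ := Nat.div_mul_cancel (hsq_dvd b₁ h0₁)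
          have e₂ := Nat.div_mul_cancel (hsq_dvd b₂ h0₂)
          have h' : b₁ / ah b₁ ^ 2 = b₂ / ah b₂ ^ 2 := h
          rw [← e₁, ← e₂, h', ha₁, ha₂]
        have hmaps : ∀ b ∈ Bset.filter (fun b => ah b = a), b / ah b ^ 2 ∈ a.divisors := by
          intro b hb
          obtain ⟨hB, hba⟩ := Finset.mem_filter.mp hb
          rw [Nat.mem_divisors]
          exact ⟨hba ▸ hquot_dvd b hB, ha0⟩
        exact_mod_cast Finset.card_le_card_of_injOn _ (fun b hb => hmaps b (by simpa using hb)) hinj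
    _ ≤ ∑ a ∈ Icc 1 X, T * (1 / (a : ℝ)) :=
        Finset.sum_le_sum fun a ha => mul_le_mul_of_nonneg_right (hT a ha) (by positivity)
    _ = T * ∑ a ∈ Icc 1 X, (1 / (a : ℝ)) := by rw [Finset.mul_sum]
    _ ≤ T * (1 + Real.log X) := mul_le_mul_of_nonneg_left (sqf_harmonic_le X) hT0

end Literature.NumberTheory.LFunctions

end
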